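import Summits.BirchSwinnertonDyer.BirchSwinnertonDyer.Theorems.PrintX9MuPartOfPrintKSClosed
import Summits.BirchSwinnertonDyer.BirchSwinnertonDyer.Theses.PrintX9
import Summits.BirchSwinnertonDyer.BirchSwinnertonDyer.Theses.PrintX10b
import HarnessLib

/-!
# `MuInequalityCoherentPairOfPrint` (stmt-BirchSwinnertonDyer-23237) — CLOSED BY NAME on routes `PrintX9` and `PrintX10b`

Cell `pub/bsd-print-x9`, road CG-FRAME (pen g14 «GO w3: CG-FRAME» 2026-08-29T00:29:56Z), `--workitem stmt-BirchSwinnertonDyer-23237`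
(x9-p1 LEAD g6, write-crux ACL).  THEOREMS ONLY.

The item `MuInequalityCoherentPairOfPrint := HowardDVRKolyvaginBound → CGLSHeegnerKolyvaginSystem →
HeegnerMuPartStabilized.MuPartStabilizedCoherentPair` is the shared deciding μ-crux of rows 9/10 in its ROUND-2 form: the
L∃ letter GIVEN only the two print leaves Howard 2004 Thm. 1.6.1 (F-161, item 23087) and CGLS 2022 Thm. 4.1.1 (F-411,
item 23236) — i.e. the closed round-3 crux 23428 `MuInequalityCoherentPairOfPrintCG` with its third leaf hCG (Greenberg LNM
1716 Prop. 2.4 for every number field / ramified `ℤ_p`-tower, item 23427) REMOVED.  It closes because that leaf, RESTRICTED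
to the μ-chain's frames (`K` imaginary quadratic, `p` odd split, `κ` anticyclotomic, `v ∣ p` good ordinary), is now the
kernel theorem `HeegnerMuPartControlGlue.kummerStrictOnFrames_holds` (road CG-FRAME) and the 23428 reduction certificate
has been re-threaded over it (KS-chain).  Both route decls are the route-free theorem
`HeegnerMuPartOfPrintKSClosed.muPartStabilizedCoherentPair_of_thm161_thm411` read through the routes' by-name leaves
(`HowardDVRKolyvaginBound := thm161_dvrKolyvaginBound`, `CGLSHeegnerKolyvaginSystem := thm411_exists_kolyvaginSystem_one_ne_zero`).
HONEST FRAMING: F-161 and F-411 are HYPOTHESES of the item's text (statement-only Literature facts, policed REF-131/132,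
REF-136/137); what this closure changes is the trust base of the μ-crux on the rows-9/10 frames: {F-161, F-411, G-2.4} →
{F-161, F-411}.  No summit statement is proved; BSD is NOT proved by this file or by anything it imports; «beyond-print
theorem»: no.

References: [Howard2004HeegnerKolyvagin] Thm. 1.6.1, proof of Thm. 2.2.10; [CastellaGrossiLeeSkinner2022] Thm. 4.1.1,
Rem. 4.1.4; [GreenbergLNM1716] Prop. 2.4; [CoatesGreenberg1996] Cor. 3.2, Prop. 4.3.
-/

set_option linter.dupNamespace false
set_option autoImplicit false

namespace Summit.BirchSwinnertonDyer.BirchSwinnertonDyer.Theorems.HeegnerMuPartOfPrintClosed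

open Summit.BirchSwinnertonDyer.BirchSwinnertonDyer.Theorems

/-- **ROW 9 — item stmt-BirchSwinnertonDyer-23237 BY NAME**: `Theses.PrintX9.MuInequalityCoherentPairOfPrint`
(`HowardDVRKolyvaginBound → CGLSHeegnerKolyvaginSystem → MuPartStabilizedCoherentPair`), from the route-free closed letter
`HeegnerMuPartOfPrintKSClosed.muPartStabilizedCoherentPair_of_thm161_thm411` (F-161 + F-411; G-2.4 discharged on the frames).
[cite: Howard2004HeegnerKolyvagin, Thm. 1.6.1 and proof of Thm. 2.2.10] [cite: CastellaGrossiLeeSkinner2022, Thm. 4.1.1, Rem. 4.1.4]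
[cite: GreenbergLNM1716, Prop. 2.4] -/
theorem muInequalityCoherentPairOfPrint_holds :
    Summit.BirchSwinnertonDyer.BirchSwinnertonDyer.Theses.PrintX9.MuInequalityCoherentPairOfPrint :=
  HeegnerMuPartOfPrintKSClosed.muPartStabilizedCoherentPair_of_thm161_thm411

/-- **ROW 10 twin — the same item over `Theses.PrintX10b`** (identical text; each leaf the same Literature constant). -/
theorem muInequalityCoherentPairOfPrint_holds_X10b :
    Summit.BirchSwinnertonDyer.BirchSwinnertonDyer.Theses.PrintX10b.MuInequalityCoherentPairOfPrint :=
  HeegnerMuPartOfPrintKSClosed.muPartStabilizedCoherentPair_of_thm161_thm411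

end Summit.BirchSwinnertonDyer.BirchSwinnertonDyer.Theorems.HeegnerMuPartOfPrintClosed
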